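import Literature.MathematicalPhysics.QuantumFieldTheory.Balaban1983to89.B9Eq3104CommutatorSizes

/-!
# `Balaban1983to89.B9Eq3104CommutatorSizesLoc` — T. Bałaban, *Propagators for lattice gauge theories in a background field*,
# Commun. Math. Phys. **99** (1985) 389–434 [Balaban1985BackgroundPropagators], p. 409 («K(h_□) … satisfies the inequality (3.89)») with Sect. C p. 414
# l. 1–3, (3.102) p. 414 and the regularity class (3.35) p. 396: **THE PRINT-SHAPE SIZE OF THE WHOLE CUT-OFF COMMUTATOR `K(h_□)(U) = [h_□, Δ_loc(U)]` OF THE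
# BOND SECTOR, WITH THE HOLONOMY HYPOTHESES LOCALISED TO THE STAR OF THE BOND** — the same four pieces and the same bound as file E′₁
# (`B9Eq3104CommutatorSizes.norm_KhBY_hTY_apply_le`), but the plaquette-holonomy defect `δ_P`, the conjugation defect `δ_K` of the Jordan insertion and the
# curvature smallness `δ_I` are now required ONLY where the proofs of D′₁ ∕ D′₂ ∕ D′₃b read them: at the plaquettes cornered at `x − e_μ` (`x = chart b₋`), at
# the site `x`, and at the plaquettes through `b` (module M5.7-est, file E′₁-loc; the level-weighted (3.89)-twin is E′₂b-loc `B9Thm310CommutatorBound389BLoc`)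

statement-level skeleton of published theorems with citation tags; proofs where landed; nothing here is a claim about the Yang–Mills mass gap

PDF held: `paper:balaban1985-cmp99-background-propagators` (journal page = PDF page + 388); pp. 396, 404, 409, 413–414 read from the text layer (`p0008`, `p0016`,
`p0021`, `p0025`–`p0026`).

WHY THIS FILE.  Print's class (3.35) p. 396 («if the index of □ is j, then |A| < O(1)Mα₀(Lʲη)⁻¹, |∇^ηA| < O(1)Mα₀(Lʲη)⁻² on □») makes the plaquette fields
POSITION-DEPENDENT: by (3.69) p. 404 («|Re U(∂p) − 1| ≤ …, |Im U(∂p)| ≤ … follow directly from the assumptions (3.35)») `|U(∂p) − 1| ≤ O(1)Mα₀·L^{−2j}` for the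
plaquettes of `Ω_j` (lattice units), small at high levels and of size `O(1)Mα₀L⁻²` at level one.  File E′₁ displays GLOBAL constants `δ_P, δ_K, δ_I`; fed with
their global suprema over the class, `δ_I ≥ c_f²|Im U(∂p)|` is of size `c_f²·O(1)Mα₀L⁻²` and the (3.89)-constant of E′₂b (`theta389B`, honest caveat «δ_P·Lʲ»)
is not `O(1)`.  Every use of the three hypotheses in D′₁ (`norm_grad_term_le`: `hP` at `σ_μ⁻¹x`), D′₂ (`norm_ins_term_le`: `hP` at `σ_μ⁻¹x`, `hKc` at `x`) and
D′₃b (`norm_cutCommR_curv2Y_hTY_apply_le`: `hI` at the plaquettes `p` with `b_m(p) = b`) is at the STAR of `b`; this file re-proves the three pieces and the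
assembly with the hypotheses restricted there, word for word otherwise (the global statements of D′₁ ∕ D′₂ ∕ D′₃b ∕ E′₁ are the special case of constant data
and are NOT modified).  The level-weighted bookkeeping (data `δ·L^{−2·lev}` ⇒ star constants `δ·L²·L^{−2·lev(x)}` ⇒ a j-UNIFORM (3.89)) is file E′₂b-loc.

## WHAT THIS FILE PROVES (THEOREMS only; 0 definitions, 0 `def … : Prop`, 0 sorry)
* §1 `norm_grad_term_le_loc`, ★ `norm_cutCommR_gradY_divY_hTY_apply_le_grad_loc` — D′₁ with `hP` only at the plaquettes `p_{μν}(x − e_μ)`, `ν = b.dir`.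
* §2 `norm_ins_term_le_loc`, ★ `norm_cutCommR_sandwich_hTY_apply_le_loc` — D′₂ with `hP` only at the plaquettes `p_{μλ}(x − e_μ)` and the conjugation defect
  `hKc` only at `x` (the insertion size `hK` stays global: for def-Y's Jordan insertion it is `|c_f|·ρ` from `‖Re U(∂p)‖ ≤ ρ`, an `O(1)` datum on the class).
* §3 ★ `norm_cutCommR_curv2Y_hTY_apply_le_loc` — D′₃b with `hI` only at the plaquettes through `b`.
* §4 ★★★ `norm_KhBY_hTY_apply_le_loc` — **E′₁'s bound VERBATIM** (`‖(K(h_□)(U)A)(b)‖ ≤ |c_f|(d+1)·4·(|c_f|ρ(2θ₁G₁ + (θ₁δ_P + θ₂)G₀) + θ₁δ_KG₀) + 64(d+1)δ_Iθ₁G₀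
  + c_f²(d+1)(2θ₁G₁ + (θ₁δ_P + θ₂)G₀) + 2θ_QP·Σ_y|Q*(b,y)|`) from the STAR-LOCAL data: `hP` at `p_{μλ}(x − e_μ)` (all `μ, λ`), `hKc` at `x`, `hI` at the plaquettes
  through `b`; `hU`, `hT`, `hRe` global as in E′₁.
HONEST SCOPE.  No (3.42)-currency, no level bookkeeping, no exponential factor here (file E′₂b-loc); nothing of Thm 3.10 ∕ 3.3 asserted; nothing landed is
modified; YM mass gap NOT proved by any of this (Track A conditional rung).  `--supports stmt-QuantumFields-19200`.  Net new unproved facts: 0.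
-/

noncomputable section

namespace Literature.MathematicalPhysics.QuantumFieldTheory.Balaban1983to89.B9Eq3104CommutatorSizesLoc

open Node00
open B9Thm37CubeCoverCommutators (cutMulY cutMulY_apply hTY hTY_apply)
open B9Thm37CubeCoverCommutatorSizes (side_conditions abs_hTY_shiftY_sub_le abs_hTY_shiftY_symm_sub_le)
open B9Eq3104CutoffCommutators (cutCommR cutCommR_apply cutCommR_add hBdY hBdY_apply KhBY deltaLocY)
open B9Eq3104CommutatorGradFormDD (shiftY_symm_shiftY_comm shiftY_shiftY_symm shiftY_symm_shiftY bondCompY_cutMulY cdB_eq_cdS_bondCompY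
  cdS_cdsS_cutMulY_apply_grad cutCommR_gradY_divY_apply)
open B9Eq3104CommutatorGradFormCurl (cdsS_ins_cdS_cutMulY_apply_grad)
open B9Eq3104CommutatorSizesDD (abs_hTY_mixed_le)
open B9Eq3104CommutatorSizesCurl (jIns norm_jIns_le hessCurlY_apply_eq)
open B9Eq3104CommutatorSizesCurv (curv2Y_apply primeEdgeY_cutMulY norm_R_edgeParY_le norm_primeEdgeY_le abs_hBdY_edge_sub_le sum_edge_indicator_le)
open B9Eq3104CommutatorSizesAvg (norm_cutCommR_QsY_aY_QY_hTY_apply_le)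
open B9Eq3104CommutatorSizes (KhBY_eq_four)
open B6KLevelCensusIndexV1 (KIdx)
open B6GlobalChartV1 (PV)
open B6MultiLevelBoxOperator (bigSide)
open B6Cover236MultiLevelBlocks (cubes)
open B6Partition118KLevelFineSizes (C1F C1F_nonneg)
open B6Partition118KLevelFineMixed (C2X C2X_bounds)
open B6Partition118KLevelTorusBinders (sLipT)
open Node00.OpsYNablaBridge (chartY bondCompY bondCompY_apply cdS_apply cdsS_apply)
open B9Eq39Adjoint (R R_smul R_sub R_zero plaqU)
open B9Eq310Hermitian (norm_R_le)
open B9Ineq369CurvatureSmallAtLettersY (norm_sgnY)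
open B13OpsYPencilHessian (norm_commY_le)
open scoped Matrix

variable {𝔸 : Type} [NormedRing 𝔸] [NormedAlgebra ℂ 𝔸] [CompleteSpace 𝔸]
variable {d ℓ : ℕ} {hd : 1 ≤ d + 1} {hL : Odd (ℓ + 1) ∧ 1 < ℓ + 1} {b₀ b₁ : ℝ}
variable (i : KIdx d ℓ hd hL b₀ b₁)

/-! ## §1 The `DD*`-piece (D′₁) with the plaquette hypothesis at the plaquettes `p_{μν}(z − e_μ)` only -/

/-- **D′₁'s `norm_grad_term_le` WITH THE PLAQUETTE HYPOTHESIS AT THE ONE PLAQUETTE IT READS** (`p_{μν}(z − e_μ)`): with `θ₁ = C1F∕(8S_j∕5)`,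
`θ₂ = C2X∕(8S_j∕5)²`, bi-contractive transporters and `‖R(U(∂p_{μν}(z − e_μ)))Y − Y‖ ≤ δ_P‖Y‖`:
`‖∇_ν∇*_μ(h_□Λ)(z) − h_□(z)•∇_ν∇*_μΛ(z)‖ ≤ θ₁‖∇*_μΛ(z+e_ν)‖ + θ₁(‖∇_νΛ(z−e_μ)‖ + δ_P‖Λ(z−e_μ+e_ν)‖) + θ₂‖Λ(z−e_μ)‖`.
[cite: Balaban1985BackgroundPropagators, p.414 l.1–3, (3.100) p.413, (3.7) p.391, (3.35) p.396; Balaban1984PropagatorsII, p.247] -/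
theorem norm_grad_term_le_loc (c : ↥(cubes i.D.toDomains)) (U : CfgY 𝔸 i)
    (hU : ∀ μ x, ‖(U μ x : 𝔸)‖ ≤ 1 ∧ ‖(((U μ x)⁻¹ : 𝔸ˣ) : 𝔸)‖ ≤ 1) {δP : ℝ} (hδP : 0 ≤ δP)
    (μ ν : Fin (d + 1)) (Λ : SiteY i → 𝔸) (z : SiteY i)
    (hP : ∀ Y : 𝔸, ‖R (plaqU (shiftY i) (UboxY i U) μ ν ((shiftY i μ).symm z)) Y - Y‖ ≤ δP * ‖Y‖) :
    ‖cdS i U ν (cdsS i U μ (cutMulY (hTY i c) Λ)) z - ((hTY i c z : ℝ) : ℂ) • cdS i U ν (cdsS i U μ Λ) z‖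
      ≤ C1F d ℓ / (8 / 5 * (bigSide ℓ i.Mh c.1.1 : ℝ)) * ‖cdsS i U μ Λ (shiftY i ν z)‖
        + C1F d ℓ / (8 / 5 * (bigSide ℓ i.Mh c.1.1 : ℝ)) * (‖cdS i U ν Λ ((shiftY i μ).symm z)‖ + δP * ‖Λ (shiftY i ν ((shiftY i μ).symm z))‖)
        + C2X d ℓ / (8 / 5 * (bigSide ℓ i.Mh c.1.1 : ℝ)) ^ 2 * ‖Λ ((shiftY i μ).symm z)‖ := by
  have hUb : ∀ μ (w : SiteY i), ‖(UboxY i U μ w : 𝔸)‖ ≤ 1 ∧ ‖(((UboxY i U μ w)⁻¹ : 𝔸ˣ) : 𝔸)‖ ≤ 1 := fun μ w => hU μ _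
  have hRle : ∀ μ (w : SiteY i) (X : 𝔸), ‖R (UboxY i U μ w) X‖ ≤ ‖X‖ := fun μ w X => norm_R_le (hUb μ w).1 (hUb μ w).2 X
  have hRle' : ∀ μ (w : SiteY i) (X : 𝔸), ‖R (UboxY i U μ w)⁻¹ X‖ ≤ ‖X‖ :=
    fun μ w X => norm_R_le (hUb μ w).2 (by rw [inv_inv]; exact (hUb μ w).1) X
  have hθ₁ : 0 ≤ C1F d ℓ / (8 / 5 * (bigSide ℓ i.Mh c.1.1 : ℝ)) := div_nonneg (C1F_nonneg d ℓ) (by positivity)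
  rw [cdS_cdsS_cutMulY_apply_grad, add_assoc, add_assoc, add_sub_cancel_left]
  -- the three gradient-form terms
  have n1 : ‖((hTY i c (shiftY i ν z) - hTY i c z : ℝ) : ℂ) • R (UboxY i U ν z) (cdsS i U μ Λ (shiftY i ν z))‖
      ≤ C1F d ℓ / (8 / 5 * (bigSide ℓ i.Mh c.1.1 : ℝ)) * ‖cdsS i U μ Λ (shiftY i ν z)‖ := by
    rw [norm_smul, Complex.norm_real, Real.norm_eq_abs]
    exact mul_le_mul (abs_hTY_shiftY_sub_le i c ν z) (hRle ν z _) (norm_nonneg _) hθ₁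
  have n2 : ‖((hTY i c (shiftY i ν ((shiftY i μ).symm z)) - hTY i c (shiftY i ν z) : ℝ) : ℂ) • R (UboxY i U μ ((shiftY i μ).symm z))⁻¹
        (cdS i U ν Λ ((shiftY i μ).symm z)
          + (R (plaqU (shiftY i) (UboxY i U) μ ν ((shiftY i μ).symm z))
                (R (UboxY i U ν ((shiftY i μ).symm z)) (Λ (shiftY i ν ((shiftY i μ).symm z))))
              - R (UboxY i U ν ((shiftY i μ).symm z)) (Λ (shiftY i ν ((shiftY i μ).symm z)))))‖
      ≤ C1F d ℓ / (8 / 5 * (bigSide ℓ i.Mh c.1.1 : ℝ)) * (‖cdS i U ν Λ ((shiftY i μ).symm z)‖ + δP * ‖Λ (shiftY i ν ((shiftY i μ).symm z))‖) := by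
    rw [norm_smul, Complex.norm_real, Real.norm_eq_abs]
    have hc : (shiftY i μ).symm (shiftY i ν z) = shiftY i ν ((shiftY i μ).symm z) := shiftY_symm_shiftY_comm i μ ν z
    have hh : |hTY i c (shiftY i ν ((shiftY i μ).symm z)) - hTY i c (shiftY i ν z)| ≤ C1F d ℓ / (8 / 5 * (bigSide ℓ i.Mh c.1.1 : ℝ)) := by
      rw [← hc]; exact abs_hTY_shiftY_symm_sub_le i c μ (shiftY i ν z)
    refine mul_le_mul hh ((hRle' μ _ _).trans ((norm_add_le _ _).trans (add_le_add le_rfl ?_))) (norm_nonneg _) hθ₁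
    exact (hP _).trans (mul_le_mul_of_nonneg_left (hRle ν _ _) hδP)
  have n3 : ‖(((hTY i c (shiftY i ν ((shiftY i μ).symm z)) - hTY i c (shiftY i ν z)) - (hTY i c ((shiftY i μ).symm z) - hTY i c z) : ℝ) : ℂ)
        • R (UboxY i U μ ((shiftY i μ).symm z))⁻¹ (Λ ((shiftY i μ).symm z))‖
      ≤ C2X d ℓ / (8 / 5 * (bigSide ℓ i.Mh c.1.1 : ℝ)) ^ 2 * ‖Λ ((shiftY i μ).symm z)‖ := by
    rw [norm_smul, Complex.norm_real, Real.norm_eq_abs]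
    exact mul_le_mul (abs_hTY_mixed_le i c μ ν z) (hRle' μ _ _) (norm_nonneg _) (div_nonneg (C2X_bounds d ℓ).2.2 (by positivity))
  have s := (norm_add_le _ _).trans (add_le_add n1 ((norm_add_le _ _).trans (add_le_add n2 n3)))
  linarith [s]

/-- ★ **D′₁'s `DD*`-PIECE OF `K(h_□)(U)` IN PRINT'S SHAPE, THE PLAQUETTE HYPOTHESIS AT THE `d + 1` PLAQUETTES `p_{μν}(x − e_μ)` ONLY** (`x = chart b₋`,
`ν = b.dir`; local bounds `G₀`, `G₁` as in D′₁):
`‖([h_□](∇_U ∘ ∇*_U))A(b)‖ ≤ c_f²·(d+1)·(2θ₁·G₁ + (θ₁·δ_P + θ₂)·G₀)`, `θ₁ = C1F∕(8S_j∕5)`, `θ₂ = C2X∕(8S_j∕5)²`.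
[cite: Balaban1985BackgroundPropagators, p.414 l.1–3, (3.100) p.413, (3.89) p.409, (3.35) p.396; Balaban1984PropagatorsII, p.247] -/
theorem norm_cutCommR_gradY_divY_hTY_apply_le_grad_loc (c : ↥(cubes i.D.toDomains)) (U : CfgY 𝔸 i)
    (hU : ∀ μ x, ‖(U μ x : 𝔸)‖ ≤ 1 ∧ ‖(((U μ x)⁻¹ : 𝔸ˣ) : 𝔸)‖ ≤ 1) {δP : ℝ} (hδP : 0 ≤ δP)
    (A : FBondY i → 𝔸) (b : FBondY i)
    (hP : ∀ (μ : Fin (d + 1)) (Y : 𝔸), ‖R (plaqU (shiftY i) (UboxY i U) μ b.dir ((shiftY i μ).symm (chartY i b.src))) Y - Y‖ ≤ δP * ‖Y‖)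
    {G₀ G₁ : ℝ}
    (hA₀ : ∀ μ, ‖bondCompY i μ A ((shiftY i μ).symm (chartY i b.src))‖ ≤ G₀
      ∧ ‖bondCompY i μ A (shiftY i b.dir ((shiftY i μ).symm (chartY i b.src)))‖ ≤ G₀)
    (hA₁ : ∀ μ, ‖cdS i U b.dir (bondCompY i μ A) ((shiftY i μ).symm (chartY i b.src))‖ ≤ G₁
      ∧ ‖cdsS i U μ (bondCompY i μ A) (shiftY i b.dir (chartY i b.src))‖ ≤ G₁) :
    ‖cutCommR (hBdY i (hTY i c)) (hBdY i (hTY i c)) (gradY i U ∘ₗ divY i U) A b‖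
      ≤ i.cf ^ 2 * (((d : ℝ) + 1) * (2 * (C1F d ℓ / (8 / 5 * (bigSide ℓ i.Mh c.1.1 : ℝ))) * G₁
          + (C1F d ℓ / (8 / 5 * (bigSide ℓ i.Mh c.1.1 : ℝ)) * δP + C2X d ℓ / (8 / 5 * (bigSide ℓ i.Mh c.1.1 : ℝ)) ^ 2) * G₀)) := by
  have hθ₁ : 0 ≤ C1F d ℓ / (8 / 5 * (bigSide ℓ i.Mh c.1.1 : ℝ)) := div_nonneg (C1F_nonneg d ℓ) (by positivity)
  have hθ₂ : 0 ≤ C2X d ℓ / (8 / 5 * (bigSide ℓ i.Mh c.1.1 : ℝ)) ^ 2 := div_nonneg (C2X_bounds d ℓ).2.2 (by positivity)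
  rw [cutCommR_gradY_divY_apply, norm_smul]
  have hc2 : ‖((i.cf ^ 2 : ℝ) : ℂ)‖ = i.cf ^ 2 := by rw [Complex.norm_real, Real.norm_eq_abs, abs_of_nonneg (sq_nonneg _)]
  rw [hc2]
  refine mul_le_mul_of_nonneg_left ?_ (sq_nonneg _)
  have per : ∀ μ : Fin (d + 1),
      ‖((hTY i c (chartY i b.src) : ℝ) : ℂ) • cdS i U b.dir (cdsS i U μ (bondCompY i μ A)) (chartY i b.src)
          - cdS i U b.dir (cdsS i U μ (cutMulY (hTY i c) (bondCompY i μ A))) (chartY i b.src)‖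
        ≤ 2 * (C1F d ℓ / (8 / 5 * (bigSide ℓ i.Mh c.1.1 : ℝ))) * G₁
          + (C1F d ℓ / (8 / 5 * (bigSide ℓ i.Mh c.1.1 : ℝ)) * δP + C2X d ℓ / (8 / 5 * (bigSide ℓ i.Mh c.1.1 : ℝ)) ^ 2) * G₀ := by
    intro μ
    rw [← norm_neg, neg_sub]
    refine (norm_grad_term_le_loc i c U hU hδP μ b.dir (bondCompY i μ A) (chartY i b.src) (hP μ)).trans ?_
    have e1 := (hA₁ μ).2
    have e2 := (hA₁ μ).1
    have e3 := (hA₀ μ).2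
    have e4 := (hA₀ μ).1
    have t1 : C1F d ℓ / (8 / 5 * (bigSide ℓ i.Mh c.1.1 : ℝ)) * ‖cdsS i U μ (bondCompY i μ A) (shiftY i b.dir (chartY i b.src))‖
        ≤ C1F d ℓ / (8 / 5 * (bigSide ℓ i.Mh c.1.1 : ℝ)) * G₁ := mul_le_mul_of_nonneg_left e1 hθ₁
    have t2 : C1F d ℓ / (8 / 5 * (bigSide ℓ i.Mh c.1.1 : ℝ)) * (‖cdS i U b.dir (bondCompY i μ A) ((shiftY i μ).symm (chartY i b.src))‖
          + δP * ‖bondCompY i μ A (shiftY i b.dir ((shiftY i μ).symm (chartY i b.src)))‖)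
        ≤ C1F d ℓ / (8 / 5 * (bigSide ℓ i.Mh c.1.1 : ℝ)) * (G₁ + δP * G₀) :=
      mul_le_mul_of_nonneg_left (add_le_add e2 (mul_le_mul_of_nonneg_left e3 hδP)) hθ₁
    have t3 : C2X d ℓ / (8 / 5 * (bigSide ℓ i.Mh c.1.1 : ℝ)) ^ 2 * ‖bondCompY i μ A ((shiftY i μ).symm (chartY i b.src))‖
        ≤ C2X d ℓ / (8 / 5 * (bigSide ℓ i.Mh c.1.1 : ℝ)) ^ 2 * G₀ := mul_le_mul_of_nonneg_left e4 hθ₂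
    have := add_le_add (add_le_add t1 t2) t3
    refine this.trans (le_of_eq ?_)
    ring
  calc ‖∑ μ : Fin (d + 1), (((hTY i c (chartY i b.src) : ℝ) : ℂ) • cdS i U b.dir (cdsS i U μ (bondCompY i μ A)) (chartY i b.src)
          - cdS i U b.dir (cdsS i U μ (cutMulY (hTY i c) (bondCompY i μ A))) (chartY i b.src))‖
      ≤ ∑ μ : Fin (d + 1), (2 * (C1F d ℓ / (8 / 5 * (bigSide ℓ i.Mh c.1.1 : ℝ))) * G₁
          + (C1F d ℓ / (8 / 5 * (bigSide ℓ i.Mh c.1.1 : ℝ)) * δP + C2X d ℓ / (8 / 5 * (bigSide ℓ i.Mh c.1.1 : ℝ)) ^ 2) * G₀) :=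
        (norm_sum_le _ _).trans (Finset.sum_le_sum fun μ _ => per μ)
    _ = _ := by rw [Finset.sum_const, Finset.card_univ, Fintype.card_fin, nsmul_eq_mul]; push_cast; ring

/-! ## §2 The Hessian-curl piece (D′₂) with the plaquette hypothesis at `p_{μλ}(x − e_μ)` and the conjugation defect at `x` only -/

/-- **D′₂'s `norm_ins_term_le` WITH THE TWO DISPLACEMENT HYPOTHESES AT THE POINTS IT READS** (`w = x − e_μ`: the plaquette `p_{μλ}(w)` and the conjugation
defect of the insertion between `w` and `x`; the insertion size `‖𝒦_zZ‖ ≤ κ‖Z‖` stays global):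
`‖∇*_μ(𝒦∇_λ(h_□Φ))(x) − h_□(x)•∇*_μ(𝒦∇_λΦ)(x)‖ ≤ κθ₁‖∇_λΦ(w)‖ + θ₁δ_K‖Φ(w+e_λ)‖ + κθ₁(‖∇*_μΦ(x+e_λ)‖ + δ_P‖Φ(w+e_λ)‖) + κθ₂‖Φ(w+e_λ)‖`.
[cite: Balaban1985BackgroundPropagators, p.414 l.1–3, (3.100) p.413, (3.10) p.392, (3.7) p.391, (3.35) p.396; Balaban1984PropagatorsII, p.247] -/
theorem norm_ins_term_le_loc (c : ↥(cubes i.D.toDomains)) (U : CfgY 𝔸 i)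
    (hU : ∀ μ x, ‖(U μ x : 𝔸)‖ ≤ 1 ∧ ‖(((U μ x)⁻¹ : 𝔸ˣ) : 𝔸)‖ ≤ 1) {δP : ℝ} (hδP : 0 ≤ δP)
    (K : SiteY i → 𝔸 →ₗ[ℂ] 𝔸) {κ δK : ℝ} (hκ : 0 ≤ κ) (hδK : 0 ≤ δK) (hK : ∀ z Z, ‖K z Z‖ ≤ κ * ‖Z‖)
    (μ lam : Fin (d + 1)) (Φ : SiteY i → 𝔸) (x : SiteY i)
    (hP : ∀ Y : 𝔸, ‖R (plaqU (shiftY i) (UboxY i U) μ lam ((shiftY i μ).symm x)) Y - Y‖ ≤ δP * ‖Y‖)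
    (hKc : ∀ Z : 𝔸, ‖R (UboxY i U μ ((shiftY i μ).symm x))⁻¹ (K ((shiftY i μ).symm x) (R (UboxY i U μ ((shiftY i μ).symm x)) Z)) - K x Z‖ ≤ δK * ‖Z‖) :
    ‖cdsS i U μ (fun z => K z (cdS i U lam (cutMulY (hTY i c) Φ) z)) x - ((hTY i c x : ℝ) : ℂ) • cdsS i U μ (fun z => K z (cdS i U lam Φ z)) x‖
      ≤ κ * (C1F d ℓ / (8 / 5 * (bigSide ℓ i.Mh c.1.1 : ℝ))) * ‖cdS i U lam Φ ((shiftY i μ).symm x)‖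
        + C1F d ℓ / (8 / 5 * (bigSide ℓ i.Mh c.1.1 : ℝ)) * δK * ‖Φ (shiftY i lam ((shiftY i μ).symm x))‖
        + κ * (C1F d ℓ / (8 / 5 * (bigSide ℓ i.Mh c.1.1 : ℝ)))
            * (‖cdsS i U μ Φ (shiftY i lam x)‖ + δP * ‖Φ (shiftY i lam ((shiftY i μ).symm x))‖)
        + κ * (C2X d ℓ / (8 / 5 * (bigSide ℓ i.Mh c.1.1 : ℝ)) ^ 2) * ‖Φ (shiftY i lam ((shiftY i μ).symm x))‖ := by
  have hUb : ∀ μ (w : SiteY i), ‖(UboxY i U μ w : 𝔸)‖ ≤ 1 ∧ ‖(((UboxY i U μ w)⁻¹ : 𝔸ˣ) : 𝔸)‖ ≤ 1 := fun μ w => hU μ _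
  have hRle : ∀ μ (w : SiteY i) (X : 𝔸), ‖R (UboxY i U μ w) X‖ ≤ ‖X‖ := fun μ w X => norm_R_le (hUb μ w).1 (hUb μ w).2 X
  have hRle' : ∀ μ (w : SiteY i) (X : 𝔸), ‖R (UboxY i U μ w)⁻¹ X‖ ≤ ‖X‖ :=
    fun μ w X => norm_R_le (hUb μ w).2 (by rw [inv_inv]; exact (hUb μ w).1) X
  have hθ₁ : 0 ≤ C1F d ℓ / (8 / 5 * (bigSide ℓ i.Mh c.1.1 : ℝ)) := div_nonneg (C1F_nonneg d ℓ) (by positivity)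
  have hθ₂ : 0 ≤ C2X d ℓ / (8 / 5 * (bigSide ℓ i.Mh c.1.1 : ℝ)) ^ 2 := div_nonneg (C2X_bounds d ℓ).2.2 (by positivity)
  rw [cdsS_ins_cdS_cutMulY_apply_grad, add_assoc, add_assoc, add_assoc, add_sub_cancel_left]
  -- sizes of `h`-coefficients
  have g1 : |hTY i c ((shiftY i μ).symm x) - hTY i c x| ≤ C1F d ℓ / (8 / 5 * (bigSide ℓ i.Mh c.1.1 : ℝ)) := abs_hTY_shiftY_symm_sub_le i c μ x
  have g2 : |hTY i c (shiftY i lam x) - hTY i c x| ≤ C1F d ℓ / (8 / 5 * (bigSide ℓ i.Mh c.1.1 : ℝ)) := abs_hTY_shiftY_sub_le i c lam x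
  have g3 : |(hTY i c (shiftY i lam ((shiftY i μ).symm x)) - hTY i c ((shiftY i μ).symm x)) - (hTY i c (shiftY i lam x) - hTY i c x)|
      ≤ C2X d ℓ / (8 / 5 * (bigSide ℓ i.Mh c.1.1 : ℝ)) ^ 2 := by
    have e := abs_hTY_mixed_le i c μ lam x
    have r : (hTY i c (shiftY i lam ((shiftY i μ).symm x)) - hTY i c ((shiftY i μ).symm x)) - (hTY i c (shiftY i lam x) - hTY i c x)
        = (hTY i c (shiftY i lam ((shiftY i μ).symm x)) - hTY i c (shiftY i lam x)) - (hTY i c ((shiftY i μ).symm x) - hTY i c x) := by ring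
    rw [r]; exact e
  -- the value `Z = R(U_μ w)⁻¹R(U_λ w)Φ(w+e_λ)` and its size
  have hZ : ‖R (UboxY i U μ ((shiftY i μ).symm x))⁻¹ (R (UboxY i U lam ((shiftY i μ).symm x)) (Φ (shiftY i lam ((shiftY i μ).symm x))))‖
      ≤ ‖Φ (shiftY i lam ((shiftY i μ).symm x))‖ := (hRle' μ _ _).trans (hRle lam _ _)
  -- the four terms
  have n1 : ‖((hTY i c ((shiftY i μ).symm x) - hTY i c x : ℝ) : ℂ) • R (UboxY i U μ ((shiftY i μ).symm x))⁻¹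
        (K ((shiftY i μ).symm x) (cdS i U lam Φ ((shiftY i μ).symm x)))‖
      ≤ κ * (C1F d ℓ / (8 / 5 * (bigSide ℓ i.Mh c.1.1 : ℝ))) * ‖cdS i U lam Φ ((shiftY i μ).symm x)‖ := by
    rw [norm_smul, Complex.norm_real, Real.norm_eq_abs]
    calc |hTY i c ((shiftY i μ).symm x) - hTY i c x| * ‖R (UboxY i U μ ((shiftY i μ).symm x))⁻¹ (K ((shiftY i μ).symm x) (cdS i U lam Φ ((shiftY i μ).symm x)))‖
        ≤ C1F d ℓ / (8 / 5 * (bigSide ℓ i.Mh c.1.1 : ℝ)) * (κ * ‖cdS i U lam Φ ((shiftY i μ).symm x)‖) :=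
          mul_le_mul g1 ((hRle' μ _ _).trans (hK _ _)) (norm_nonneg _) hθ₁
      _ = _ := by ring
  have n2 : ‖((hTY i c (shiftY i lam x) - hTY i c x : ℝ) : ℂ) •
        (R (UboxY i U μ ((shiftY i μ).symm x))⁻¹ (K ((shiftY i μ).symm x) (R (UboxY i U μ ((shiftY i μ).symm x))
            (R (UboxY i U μ ((shiftY i μ).symm x))⁻¹
              (R (UboxY i U lam ((shiftY i μ).symm x)) (Φ (shiftY i lam ((shiftY i μ).symm x)))))))
          - K x (R (UboxY i U μ ((shiftY i μ).symm x))⁻¹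
              (R (UboxY i U lam ((shiftY i μ).symm x)) (Φ (shiftY i lam ((shiftY i μ).symm x))))))‖
      ≤ C1F d ℓ / (8 / 5 * (bigSide ℓ i.Mh c.1.1 : ℝ)) * δK * ‖Φ (shiftY i lam ((shiftY i μ).symm x))‖ := by
    rw [norm_smul, Complex.norm_real, Real.norm_eq_abs, mul_assoc]
    exact mul_le_mul g2 ((hKc _).trans (mul_le_mul_of_nonneg_left hZ hδK)) (norm_nonneg _) hθ₁
  have n3 : ‖((hTY i c (shiftY i lam x) - hTY i c x : ℝ) : ℂ) • K x
        (R (UboxY i U lam x) (cdsS i U μ Φ (shiftY i lam x))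
          + R (UboxY i U μ ((shiftY i μ).symm x))⁻¹
              (R (UboxY i U lam ((shiftY i μ).symm x)) (Φ (shiftY i lam ((shiftY i μ).symm x)))
                - R (plaqU (shiftY i) (UboxY i U) μ lam ((shiftY i μ).symm x))
                    (R (UboxY i U lam ((shiftY i μ).symm x)) (Φ (shiftY i lam ((shiftY i μ).symm x))))))‖
      ≤ κ * (C1F d ℓ / (8 / 5 * (bigSide ℓ i.Mh c.1.1 : ℝ)))
          * (‖cdsS i U μ Φ (shiftY i lam x)‖ + δP * ‖Φ (shiftY i lam ((shiftY i μ).symm x))‖) := by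
    rw [norm_smul, Complex.norm_real, Real.norm_eq_abs]
    have hin : ‖R (UboxY i U lam x) (cdsS i U μ Φ (shiftY i lam x))
          + R (UboxY i U μ ((shiftY i μ).symm x))⁻¹
              (R (UboxY i U lam ((shiftY i μ).symm x)) (Φ (shiftY i lam ((shiftY i μ).symm x)))
                - R (plaqU (shiftY i) (UboxY i U) μ lam ((shiftY i μ).symm x))
                    (R (UboxY i U lam ((shiftY i μ).symm x)) (Φ (shiftY i lam ((shiftY i μ).symm x)))))‖
        ≤ ‖cdsS i U μ Φ (shiftY i lam x)‖ + δP * ‖Φ (shiftY i lam ((shiftY i μ).symm x))‖ := by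
      refine (norm_add_le _ _).trans (add_le_add (hRle lam _ _) ((hRle' μ _ _).trans ?_))
      rw [← norm_neg, neg_sub]
      exact (hP _).trans (mul_le_mul_of_nonneg_left (hRle lam _ _) hδP)
    calc |hTY i c (shiftY i lam x) - hTY i c x| * ‖K x (R (UboxY i U lam x) (cdsS i U μ Φ (shiftY i lam x))
            + R (UboxY i U μ ((shiftY i μ).symm x))⁻¹
                (R (UboxY i U lam ((shiftY i μ).symm x)) (Φ (shiftY i lam ((shiftY i μ).symm x)))
                  - R (plaqU (shiftY i) (UboxY i U) μ lam ((shiftY i μ).symm x))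
                      (R (UboxY i U lam ((shiftY i μ).symm x)) (Φ (shiftY i lam ((shiftY i μ).symm x))))))‖
        ≤ C1F d ℓ / (8 / 5 * (bigSide ℓ i.Mh c.1.1 : ℝ))
            * (κ * (‖cdsS i U μ Φ (shiftY i lam x)‖ + δP * ‖Φ (shiftY i lam ((shiftY i μ).symm x))‖)) :=
          mul_le_mul g2 ((hK _ _).trans (mul_le_mul_of_nonneg_left hin hκ)) (norm_nonneg _) hθ₁
      _ = _ := by ring
  have n4 : ‖(((hTY i c (shiftY i lam ((shiftY i μ).symm x)) - hTY i c ((shiftY i μ).symm x)) - (hTY i c (shiftY i lam x) - hTY i c x) : ℝ) : ℂ)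
        • R (UboxY i U μ ((shiftY i μ).symm x))⁻¹
            (K ((shiftY i μ).symm x) (R (UboxY i U lam ((shiftY i μ).symm x)) (Φ (shiftY i lam ((shiftY i μ).symm x)))))‖
      ≤ κ * (C2X d ℓ / (8 / 5 * (bigSide ℓ i.Mh c.1.1 : ℝ)) ^ 2) * ‖Φ (shiftY i lam ((shiftY i μ).symm x))‖ := by
    rw [norm_smul, Complex.norm_real, Real.norm_eq_abs]
    calc |(hTY i c (shiftY i lam ((shiftY i μ).symm x)) - hTY i c ((shiftY i μ).symm x)) - (hTY i c (shiftY i lam x) - hTY i c x)|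
          * ‖R (UboxY i U μ ((shiftY i μ).symm x))⁻¹
              (K ((shiftY i μ).symm x) (R (UboxY i U lam ((shiftY i μ).symm x)) (Φ (shiftY i lam ((shiftY i μ).symm x)))))‖
        ≤ C2X d ℓ / (8 / 5 * (bigSide ℓ i.Mh c.1.1 : ℝ)) ^ 2 * (κ * ‖Φ (shiftY i lam ((shiftY i μ).symm x))‖) :=
          mul_le_mul g3 ((hRle' μ _ _).trans ((hK _ _).trans (mul_le_mul_of_nonneg_left (hRle lam _ _) hκ))) (norm_nonneg _) hθ₂
      _ = _ := by ring
  have s := (norm_add_le _ _).trans (add_le_add n1 ((norm_add_le _ _).trans (add_le_add n2 ((norm_add_le _ _).trans (add_le_add n3 n4)))))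
  linarith [s]

/-- ★ **D′₂'s HESSIAN-CURL-TYPE PIECE OF `K(h_□)(U)` IN PRINT'S SHAPE, STAR-LOCAL DATA** — for a bond operator `T` with the COMPONENT FORM of
`D*_U ∘ 𝒦 ∘ D_U` (hypothesis `hT`), an insertion family `𝒦_{ae,z}` with `‖𝒦Z‖ ≤ κ‖Z‖` (global), conjugation defect `δ_K` AT `x = chart b₋` (between `x − e_μ`
and `x`, every `μ`), bi-contractive `U`, plaquette-holonomy defect `δ_P` AT THE PLAQUETTES `p_{μλ}(x − e_μ)` (every `μ, λ`), and D′₂'s local bounds `G₀`, `G₁`: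
`‖([h_□]T)A(b)‖ ≤ |c_f|·(d+1)·4·(κ(2θ₁G₁ + (θ₁δ_P + θ₂)G₀) + θ₁δ_KG₀)`.
[cite: Balaban1985BackgroundPropagators, p.414 l.1–3, (3.100) p.413, (3.4) p.391, (3.9)–(3.10) p.392, (3.89) p.409, (3.35) p.396; Balaban1984PropagatorsII, p.247] -/
theorem norm_cutCommR_sandwich_hTY_apply_le_loc (c : ↥(cubes i.D.toDomains)) (U : CfgY 𝔸 i)
    (hU : ∀ μ x, ‖(U μ x : 𝔸)‖ ≤ 1 ∧ ‖(((U μ x)⁻¹ : 𝔸ˣ) : 𝔸)‖ ≤ 1) {δP : ℝ} (hδP : 0 ≤ δP)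
    (Kf : Fin (d + 1) → Fin (d + 1) → SiteY i → 𝔸 →ₗ[ℂ] 𝔸) {κ δK : ℝ} (hκ : 0 ≤ κ) (hδK : 0 ≤ δK)
    (hK : ∀ a e z Z, ‖Kf a e z Z‖ ≤ κ * ‖Z‖)
    (T : (FBondY i → 𝔸) →ₗ[ℂ] (FBondY i → 𝔸))
    (hT : ∀ (A : FBondY i → 𝔸) (b : FBondY i), T A b = ((i.cf : ℝ) : ℂ) • ∑ μ : Fin (d + 1),
      (cdsS i U μ (fun z => Kf μ b.dir z (cdS i U μ (bondCompY i b.dir A) z) - Kf μ b.dir z (cdS i U b.dir (bondCompY i μ A) z)) (chartY i b.src)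
        - cdsS i U μ (fun z => Kf b.dir μ z (cdS i U b.dir (bondCompY i μ A) z) - Kf b.dir μ z (cdS i U μ (bondCompY i b.dir A) z))
            (chartY i b.src)))
    (A : FBondY i → 𝔸) (b : FBondY i)
    (hP : ∀ (μ lam : Fin (d + 1)) (Y : 𝔸), ‖R (plaqU (shiftY i) (UboxY i U) μ lam ((shiftY i μ).symm (chartY i b.src))) Y - Y‖ ≤ δP * ‖Y‖)
    (hKc : ∀ a e (μ : Fin (d + 1)) (Z : 𝔸),
      ‖R (UboxY i U μ ((shiftY i μ).symm (chartY i b.src)))⁻¹ (Kf a e ((shiftY i μ).symm (chartY i b.src))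
          (R (UboxY i U μ ((shiftY i μ).symm (chartY i b.src))) Z)) - Kf a e (chartY i b.src) Z‖ ≤ δK * ‖Z‖)
    {G₀ G₁ : ℝ}
    (hA₀ : ∀ a lam μ : Fin (d + 1), ‖bondCompY i a A (shiftY i lam ((shiftY i μ).symm (chartY i b.src)))‖ ≤ G₀)
    (hA₁ : ∀ a lam μ : Fin (d + 1), ‖cdS i U lam (bondCompY i a A) ((shiftY i μ).symm (chartY i b.src))‖ ≤ G₁
      ∧ ‖cdsS i U μ (bondCompY i a A) (shiftY i lam (chartY i b.src))‖ ≤ G₁) :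
    ‖cutCommR (hBdY i (hTY i c)) (hBdY i (hTY i c)) T A b‖
      ≤ |i.cf| * (((d : ℝ) + 1) * (4 * (κ * (2 * (C1F d ℓ / (8 / 5 * (bigSide ℓ i.Mh c.1.1 : ℝ))) * G₁
          + (C1F d ℓ / (8 / 5 * (bigSide ℓ i.Mh c.1.1 : ℝ)) * δP + C2X d ℓ / (8 / 5 * (bigSide ℓ i.Mh c.1.1 : ℝ)) ^ 2) * G₀)
          + C1F d ℓ / (8 / 5 * (bigSide ℓ i.Mh c.1.1 : ℝ)) * δK * G₀))) := by
  have hθ₁ : 0 ≤ C1F d ℓ / (8 / 5 * (bigSide ℓ i.Mh c.1.1 : ℝ)) := div_nonneg (C1F_nonneg d ℓ) (by positivity)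
  have hθ₂ : 0 ≤ C2X d ℓ / (8 / 5 * (bigSide ℓ i.Mh c.1.1 : ℝ)) ^ 2 := div_nonneg (C2X_bounds d ℓ).2.2 (by positivity)
  -- abbreviations
  set θ₁ := C1F d ℓ / (8 / 5 * (bigSide ℓ i.Mh c.1.1 : ℝ)) with hθ₁def
  set θ₂ := C2X d ℓ / (8 / 5 * (bigSide ℓ i.Mh c.1.1 : ℝ)) ^ 2 with hθ₂def
  set x := chartY i b.src with hxdef
  set h := hTY i c with hhdef
  -- one instance of `norm_ins_term_le_loc`, read against the local bounds
  have inst : ∀ (a e μ lam a' : Fin (d + 1)),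
      ‖cdsS i U μ (fun z => Kf a e z (cdS i U lam (cutMulY h (bondCompY i a' A)) z)) x
          - ((h x : ℝ) : ℂ) • cdsS i U μ (fun z => Kf a e z (cdS i U lam (bondCompY i a' A) z)) x‖
        ≤ κ * (2 * θ₁ * G₁ + (θ₁ * δP + θ₂) * G₀) + θ₁ * δK * G₀ := by
    intro a e μ lam a'
    refine (norm_ins_term_le_loc i c U hU hδP (Kf a e) hκ hδK (hK a e) μ lam (bondCompY i a' A) x (hP μ lam) (hKc a e μ)).trans ?_
    have e1 := (hA₁ a' lam μ).1
    have e2 := (hA₁ a' lam μ).2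
    have e3 := hA₀ a' lam μ
    have t1 : κ * θ₁ * ‖cdS i U lam (bondCompY i a' A) ((shiftY i μ).symm x)‖ ≤ κ * θ₁ * G₁ := mul_le_mul_of_nonneg_left e1 (mul_nonneg hκ hθ₁)
    have t2 : θ₁ * δK * ‖bondCompY i a' A (shiftY i lam ((shiftY i μ).symm x))‖ ≤ θ₁ * δK * G₀ := mul_le_mul_of_nonneg_left e3 (mul_nonneg hθ₁ hδK)
    have t3 : κ * θ₁ * (‖cdsS i U μ (bondCompY i a' A) (shiftY i lam x)‖ + δP * ‖bondCompY i a' A (shiftY i lam ((shiftY i μ).symm x))‖)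
        ≤ κ * θ₁ * (G₁ + δP * G₀) := mul_le_mul_of_nonneg_left (add_le_add e2 (mul_le_mul_of_nonneg_left e3 hδP)) (mul_nonneg hκ hθ₁)
    have t4 : κ * θ₂ * ‖bondCompY i a' A (shiftY i lam ((shiftY i μ).symm x))‖ ≤ κ * θ₂ * G₀ := mul_le_mul_of_nonneg_left e3 (mul_nonneg hκ hθ₂)
    have := add_le_add (add_le_add (add_le_add t1 t2) t3) t4
    refine this.trans (le_of_eq ?_)
    ring
  -- the commutator through the component form
  have hcomp : ∀ a : Fin (d + 1), bondCompY i a (cutMulY (hBdY i h) A) = cutMulY h (bondCompY i a A) := fun a => bondCompY_cutMulY i h a A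
  rw [cutCommR_apply, hT, hT, hBdY_apply]
  simp only [hcomp]
  rw [← hxdef, smul_comm (((h x : ℝ)) : ℂ), ← smul_sub, norm_smul, Complex.norm_real, Real.norm_eq_abs, Finset.smul_sum, ← Finset.sum_sub_distrib]
  refine mul_le_mul_of_nonneg_left ?_ (abs_nonneg _)
  -- per `μ`: four instances
  have per : ∀ μ : Fin (d + 1),
      ‖((h x : ℝ) : ℂ) • (cdsS i U μ (fun z => Kf μ b.dir z (cdS i U μ (bondCompY i b.dir A) z) - Kf μ b.dir z (cdS i U b.dir (bondCompY i μ A) z)) x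
            - cdsS i U μ (fun z => Kf b.dir μ z (cdS i U b.dir (bondCompY i μ A) z) - Kf b.dir μ z (cdS i U μ (bondCompY i b.dir A) z)) x)
        - (cdsS i U μ (fun z => Kf μ b.dir z (cdS i U μ (cutMulY h (bondCompY i b.dir A)) z)
              - Kf μ b.dir z (cdS i U b.dir (cutMulY h (bondCompY i μ A)) z)) x
            - cdsS i U μ (fun z => Kf b.dir μ z (cdS i U b.dir (cutMulY h (bondCompY i μ A)) z)
              - Kf b.dir μ z (cdS i U μ (cutMulY h (bondCompY i b.dir A)) z)) x)‖
        ≤ 4 * (κ * (2 * θ₁ * G₁ + (θ₁ * δP + θ₂) * G₀) + θ₁ * δK * G₀) := by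
    intro μ
    have split : ∀ (F G : SiteY i → 𝔸), cdsS i U μ (fun z => F z - G z) x = cdsS i U μ F x - cdsS i U μ G x := by
      intro F G; simp only [cdsS_apply, R_sub]; abel
    rw [split, split, split, split]
    have i1 := inst μ b.dir μ μ b.dir
    have i2 := inst μ b.dir μ b.dir μ
    have i3 := inst b.dir μ μ b.dir μ
    have i4 := inst b.dir μ μ μ b.dir
    have e : ((h x : ℝ) : ℂ) • (cdsS i U μ (fun z => Kf μ b.dir z (cdS i U μ (bondCompY i b.dir A) z)) x
              - cdsS i U μ (fun z => Kf μ b.dir z (cdS i U b.dir (bondCompY i μ A) z)) x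
              - (cdsS i U μ (fun z => Kf b.dir μ z (cdS i U b.dir (bondCompY i μ A) z)) x
                  - cdsS i U μ (fun z => Kf b.dir μ z (cdS i U μ (bondCompY i b.dir A) z)) x))
          - (cdsS i U μ (fun z => Kf μ b.dir z (cdS i U μ (cutMulY h (bondCompY i b.dir A)) z)) x
              - cdsS i U μ (fun z => Kf μ b.dir z (cdS i U b.dir (cutMulY h (bondCompY i μ A)) z)) x
              - (cdsS i U μ (fun z => Kf b.dir μ z (cdS i U b.dir (cutMulY h (bondCompY i μ A)) z)) x
                  - cdsS i U μ (fun z => Kf b.dir μ z (cdS i U μ (cutMulY h (bondCompY i b.dir A)) z)) x))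
        = -(cdsS i U μ (fun z => Kf μ b.dir z (cdS i U μ (cutMulY h (bondCompY i b.dir A)) z)) x
              - ((h x : ℝ) : ℂ) • cdsS i U μ (fun z => Kf μ b.dir z (cdS i U μ (bondCompY i b.dir A) z)) x)
          + (cdsS i U μ (fun z => Kf μ b.dir z (cdS i U b.dir (cutMulY h (bondCompY i μ A)) z)) x
              - ((h x : ℝ) : ℂ) • cdsS i U μ (fun z => Kf μ b.dir z (cdS i U b.dir (bondCompY i μ A) z)) x)
          + (cdsS i U μ (fun z => Kf b.dir μ z (cdS i U b.dir (cutMulY h (bondCompY i μ A)) z)) x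
              - ((h x : ℝ) : ℂ) • cdsS i U μ (fun z => Kf b.dir μ z (cdS i U b.dir (bondCompY i μ A) z)) x)
          - (cdsS i U μ (fun z => Kf b.dir μ z (cdS i U μ (cutMulY h (bondCompY i b.dir A)) z)) x
              - ((h x : ℝ) : ℂ) • cdsS i U μ (fun z => Kf b.dir μ z (cdS i U μ (bondCompY i b.dir A) z)) x) := by
      simp only [smul_sub]; abel
    rw [e]
    have s := (norm_sub_le _ _).trans (add_le_add ((norm_add_le _ _).trans (add_le_add ((norm_add_le _ _).trans
      (add_le_add (le_of_eq (norm_neg _) |>.trans i1) i2)) i3)) i4)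
    linarith [s]
  calc ‖∑ μ : Fin (d + 1), (((h x : ℝ) : ℂ) • (cdsS i U μ (fun z => Kf μ b.dir z (cdS i U μ (bondCompY i b.dir A) z)
              - Kf μ b.dir z (cdS i U b.dir (bondCompY i μ A) z)) x
            - cdsS i U μ (fun z => Kf b.dir μ z (cdS i U b.dir (bondCompY i μ A) z) - Kf b.dir μ z (cdS i U μ (bondCompY i b.dir A) z)) x)
        - (cdsS i U μ (fun z => Kf μ b.dir z (cdS i U μ (cutMulY h (bondCompY i b.dir A)) z)
              - Kf μ b.dir z (cdS i U b.dir (cutMulY h (bondCompY i μ A)) z)) x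
            - cdsS i U μ (fun z => Kf b.dir μ z (cdS i U b.dir (cutMulY h (bondCompY i μ A)) z)
              - Kf b.dir μ z (cdS i U μ (cutMulY h (bondCompY i b.dir A)) z)) x))‖
      ≤ ∑ μ : Fin (d + 1), 4 * (κ * (2 * θ₁ * G₁ + (θ₁ * δP + θ₂) * G₀) + θ₁ * δK * G₀) :=
        (norm_sum_le _ _).trans (Finset.sum_le_sum fun μ _ => per μ)
    _ = _ := by rw [Finset.sum_const, Finset.card_univ, Fintype.card_fin, nsmul_eq_mul]; push_cast; ring

/-! ## §3 The curvature piece (D′₃b) with the `Im`-smallness at the plaquettes through `b` only -/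

/-- ★ **D′₃b's CURVATURE PIECE `[h_□, Δ′₂(U)]` OF `K(h_□)(U)` IN PRINT'S SHAPE, THE SMALLNESS `‖c_f²·Im U(∂p)‖ ≤ δ_I` REQUIRED ONLY AT THE PLAQUETTES
THROUGH `b`** (`b_m(p) = b` for some contour position `m`): `‖([h_□]Δ′₂(U))A(b)‖ ≤ 64(d+1)·δ_I·θ₁·G₀`, `θ₁ = C1F∕(8S_j∕5)`.
[cite: Balaban1985BackgroundPropagators, (3.10) p.392, (3.89) p.409, p.414 l.1–3, (3.35) p.396, (3.69) p.404] -/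
theorem norm_cutCommR_curv2Y_hTY_apply_le_loc (c : ↥(cubes i.D.toDomains)) (U : CfgY 𝔸 i)
    (hU : ∀ μ x, ‖(U μ x : 𝔸)‖ ≤ 1 ∧ ‖(((U μ x)⁻¹ : 𝔸ˣ) : 𝔸)‖ ≤ 1) {δI : ℝ} (hδI : 0 ≤ δI)
    (A : FBondY i → 𝔸) (b : FBondY i)
    (hI : ∀ (p : PlaqY i) (m : Fin 4), edgeY i p m = b → ‖((i.cf ^ 2 : ℝ) : ℂ) • imHolY i U p‖ ≤ δI)
    {G₀ : ℝ} (hG₀ : 0 ≤ G₀) (hA : ∀ (p : PlaqY i) (m l : Fin 4), edgeY i p m = b → ‖A (edgeY i p l)‖ ≤ G₀) :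
    ‖cutCommR (hBdY i (hTY i c)) (hBdY i (hTY i c)) (curv2Y i U) A b‖
      ≤ 64 * ((d : ℝ) + 1) * δI * (C1F d ℓ / (8 / 5 * (bigSide ℓ i.Mh c.1.1 : ℝ))) * G₀ := by
  classical
  have hθ : 0 ≤ C1F d ℓ / (8 / 5 * (bigSide ℓ i.Mh c.1.1 : ℝ)) := div_nonneg (C1F_nonneg d ℓ) (by positivity)
  set θ₁ := C1F d ℓ / (8 / 5 * (bigSide ℓ i.Mh c.1.1 : ℝ)) with hθ₁
  set h := hTY i c with hh
  set S : PlaqY i → Fin 4 → (FBondY i → 𝔸) → 𝔸 := fun p m X =>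
    (∑ l : Fin 4, (if m < l then primeEdgeY i U p l else 0)) X - (∑ l : Fin 4, (if l < m then primeEdgeY i U p l else 0)) X with hS
  set T : PlaqY i → Fin 4 → (FBondY i → 𝔸) → 𝔸 := fun p m X =>
    if edgeY i p m = b then sgnY m • R (edgeParY i U p m)⁻¹ (commY (((i.cf ^ 2 : ℝ) : ℂ) • imHolY i U p) (S p m X)) else 0 with hT
  have happ : ∀ X, curv2Y i U X b = (1 / 2 : ℂ) • ∑ p : PlaqY i, ∑ m : Fin 4, T p m X := fun X => curv2Y_apply i U X b
  have hSsize : ∀ (p : PlaqY i) (m : Fin 4), edgeY i p m = b →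
      ‖((h (chartY i b.src) : ℝ) : ℂ) • S p m A - S p m (cutMulY (hBdY i h) A)‖ ≤ 2 * (4 * (2 * θ₁ * G₀)) := by
    intro p m hpm
    have hl : ∀ l : Fin 4, ‖((h (chartY i b.src) : ℝ) : ℂ) • primeEdgeY i U p l A - primeEdgeY i U p l (cutMulY (hBdY i h) A)‖ ≤ 2 * θ₁ * G₀ := by
      intro l
      rw [primeEdgeY_cutMulY, ← sub_smul, ← Complex.ofReal_sub, norm_smul, Complex.norm_real, Real.norm_eq_abs]
      have e1 : |h (chartY i b.src) - h (chartY i (edgeY i p l).src)| ≤ 2 * θ₁ := by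
        have := abs_hBdY_edge_sub_le i c p m l
        rwa [hpm, hBdY_apply, hBdY_apply] at this
      exact mul_le_mul e1 ((norm_primeEdgeY_le i U hU p l A).trans (hA p m l hpm)) (norm_nonneg _) (by positivity)
    have hsum : ∀ (P : Fin 4 → Prop) [DecidablePred P],
        ‖((h (chartY i b.src) : ℝ) : ℂ) • (∑ l : Fin 4, (if P l then primeEdgeY i U p l else 0)) A
            - (∑ l : Fin 4, (if P l then primeEdgeY i U p l else 0)) (cutMulY (hBdY i h) A)‖ ≤ 4 * (2 * θ₁ * G₀) := by
      intro P _
      rw [LinearMap.coe_sum, Finset.sum_apply, Finset.sum_apply, Finset.smul_sum, ← Finset.sum_sub_distrib]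
      calc ‖∑ l : Fin 4, (((h (chartY i b.src) : ℝ) : ℂ) • (if P l then primeEdgeY i U p l else 0) A
              - (if P l then primeEdgeY i U p l else 0) (cutMulY (hBdY i h) A))‖
          ≤ ∑ l : Fin 4, (2 * θ₁ * G₀) := by
            refine (norm_sum_le _ _).trans (Finset.sum_le_sum fun l _ => ?_)
            split_ifs with hP
            · exact hl l
            · rw [LinearMap.zero_apply, LinearMap.zero_apply, smul_zero, sub_zero, norm_zero]; positivity
        _ = 4 * (2 * θ₁ * G₀) := by simp
    have e : ((h (chartY i b.src) : ℝ) : ℂ) • S p m A - S p m (cutMulY (hBdY i h) A)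
        = (((h (chartY i b.src) : ℝ) : ℂ) • (∑ l : Fin 4, (if m < l then primeEdgeY i U p l else 0)) A
            - (∑ l : Fin 4, (if m < l then primeEdgeY i U p l else 0)) (cutMulY (hBdY i h) A))
          - (((h (chartY i b.src) : ℝ) : ℂ) • (∑ l : Fin 4, (if l < m then primeEdgeY i U p l else 0)) A
            - (∑ l : Fin 4, (if l < m then primeEdgeY i U p l else 0)) (cutMulY (hBdY i h) A)) := by
      simp only [hS, smul_sub]; abel
    rw [e]
    exact (norm_sub_le _ _).trans (by linarith [hsum (fun l => m < l), hsum (fun l => l < m)])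
  have hTsize : ∀ (p : PlaqY i) (m : Fin 4),
      ‖((h (chartY i b.src) : ℝ) : ℂ) • T p m A - T p m (cutMulY (hBdY i h) A)‖
        ≤ if edgeY i p m = b then 2 * δI * (2 * (4 * (2 * θ₁ * G₀))) else 0 := by
    intro p m
    by_cases hpm : edgeY i p m = b
    · simp only [hT, if_pos hpm]
      rw [smul_comm, ← smul_sub, ← R_smul, ← R_sub, ← LinearMap.map_smul_of_tower, ← map_sub, norm_smul, norm_sgnY, one_mul]
      refine (norm_R_edgeParY_le i U hU p m _).2.trans ((norm_commY_le _ _).trans ?_)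
      exact mul_le_mul (mul_le_mul_of_nonneg_left (hI p m hpm) (by norm_num)) (hSsize p m hpm) (norm_nonneg _) (by positivity)
    · simp only [hT, if_neg hpm, smul_zero, sub_zero, norm_zero, le_refl]
  rw [cutCommR_apply, happ, happ, hBdY_apply, smul_comm, ← smul_sub, norm_smul, Finset.smul_sum, ← Finset.sum_sub_distrib]
  have hn : ‖(1 / 2 : ℂ)‖ = 1 / 2 := by norm_num
  rw [hn]
  have inner : ‖∑ p : PlaqY i, (((h (chartY i b.src) : ℝ) : ℂ) • ∑ m : Fin 4, T p m A - ∑ m : Fin 4, T p m (cutMulY (hBdY i h) A))‖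
      ≤ ∑ p : PlaqY i, ∑ m : Fin 4, (if edgeY i p m = b then 2 * δI * (2 * (4 * (2 * θ₁ * G₀))) else 0) := by
    refine (norm_sum_le _ _).trans (Finset.sum_le_sum fun p _ => ?_)
    rw [Finset.smul_sum, ← Finset.sum_sub_distrib]
    exact (norm_sum_le _ _).trans (Finset.sum_le_sum fun m _ => hTsize p m)
  have cnt := sum_edge_indicator_le i b
  have factor : (∑ p : PlaqY i, ∑ m : Fin 4, (if edgeY i p m = b then 2 * δI * (2 * (4 * (2 * θ₁ * G₀))) else 0))
      = (2 * δI * (2 * (4 * (2 * θ₁ * G₀)))) * ∑ p : PlaqY i, ∑ m : Fin 4, (if edgeY i p m = b then (1 : ℝ) else 0) := by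
    rw [Finset.mul_sum]
    refine Finset.sum_congr rfl fun p _ => ?_
    rw [Finset.mul_sum]
    refine Finset.sum_congr rfl fun m _ => ?_
    split_ifs <;> simp
  rw [factor] at inner
  have hK : 0 ≤ 2 * δI * (2 * (4 * (2 * θ₁ * G₀))) := by positivity
  calc 1 / 2 * ‖∑ p : PlaqY i, (((h (chartY i b.src) : ℝ) : ℂ) • ∑ m : Fin 4, T p m A - ∑ m : Fin 4, T p m (cutMulY (hBdY i h) A))‖
      ≤ 1 / 2 * ((2 * δI * (2 * (4 * (2 * θ₁ * G₀)))) * (4 * ((d : ℝ) + 1))) :=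
        mul_le_mul_of_nonneg_left (inner.trans (mul_le_mul_of_nonneg_left cnt hK)) (by norm_num)
    _ = _ := by ring

/-! ## §4 The whole cut-off commutator `K(h_□)(U)` at a bond, star-local data -/

/-- ★★★ **E′₁'s `K(h_□)(U)A` AT A BOND, SIZED IN PRINT'S SHAPE, FROM STAR-LOCAL HOLONOMY DATA — p. 409 ∕ p. 414 with the class (3.35) p. 396.**  The bound is
E′₁'s `norm_KhBY_hTY_apply_le` VERBATIM; of its displayed class data only `hU` (bi-contractive bond variables), `hT` (contractive contour transporters of the
averagings) and `hRe` (`‖Re U(∂p)‖ ≤ ρ`, an `O(1)` datum) stay global, while the three SMALL data are read where the proof reads them: the plaquette-holonomy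
defect `δ_P` at the plaquettes `p_{μλ}(x − e_μ)` (`x = chart b₋`, all `μ, λ`), the conjugation defect `δ_K` of the Jordan insertion between `x − e_μ` and `x`,
the curvature smallness `‖c_f²·Im U(∂p)‖ ≤ δ_I` at the plaquettes through `b`:
`‖(K(h_□)(U)A)(b)‖ ≤ |c_f|(d+1)·4·(|c_f|ρ(2θ₁G₁ + (θ₁δ_P + θ₂)G₀) + θ₁δ_KG₀) + 64(d+1)δ_Iθ₁G₀ + c_f²(d+1)(2θ₁G₁ + (θ₁δ_P + θ₂)G₀) + 2θ_QP·Σ_y|Q*(b,y)|`,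
`θ₁ = C1F∕(8S_j∕5)`, `θ₂ = C2X∕(8S_j∕5)²`, `θ_Q = sLipT∕(L·M_h)·(L+3)`.
[cite: Balaban1985BackgroundPropagators, (3.89) p.409 («K(h_□) … satisfies the inequality (3.89)»), p.414 l.1–3, (3.102) p.414, (3.10) p.392, (3.35) p.396, (3.69) p.404; Balaban1984PropagatorsII, p.247] -/
theorem norm_KhBY_hTY_apply_le_loc (c : ↥(cubes i.D.toDomains)) (parB : BondParY 𝔸 i) (U : CfgY 𝔸 i)
    (hU : ∀ μ x, ‖(U μ x : 𝔸)‖ ≤ 1 ∧ ‖(((U μ x)⁻¹ : 𝔸ˣ) : 𝔸)‖ ≤ 1)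
    (hT : ∀ (y : IBondY i) (f : FBondY i), ‖(qT i parB U y f : 𝔸)‖ ≤ 1 ∧ ‖(((qT i parB U y f)⁻¹ : 𝔸ˣ) : 𝔸)‖ ≤ 1)
    {δP ρ δK δI : ℝ} (hδP : 0 ≤ δP) (hρ : 0 ≤ ρ) (hδK : 0 ≤ δK) (hδI : 0 ≤ δI)
    (hRe : ∀ p : PlaqY i, ‖reHolY i U p‖ ≤ ρ)
    (A : FBondY i → 𝔸) (b : FBondY i)
    (hP : ∀ (μ lam : Fin (d + 1)) (Y : 𝔸), ‖R (plaqU (shiftY i) (UboxY i U) μ lam ((shiftY i μ).symm (chartY i b.src))) Y - Y‖ ≤ δP * ‖Y‖)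
    (hKc : ∀ a e (μ : Fin (d + 1)) (Z : 𝔸),
      ‖R (UboxY i U μ ((shiftY i μ).symm (chartY i b.src)))⁻¹ (jIns i U a e ((shiftY i μ).symm (chartY i b.src))
          (R (UboxY i U μ ((shiftY i μ).symm (chartY i b.src))) Z)) - jIns i U a e (chartY i b.src) Z‖ ≤ δK * ‖Z‖)
    (hI : ∀ (p : PlaqY i) (m : Fin 4), edgeY i p m = b → ‖((i.cf ^ 2 : ℝ) : ℂ) • imHolY i U p‖ ≤ δI)
    {G₀ G₁ P : ℝ} (hG₀ : 0 ≤ G₀)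
    (hA₀ : ∀ a lam μ : Fin (d + 1), ‖bondCompY i a A ((shiftY i μ).symm (chartY i b.src))‖ ≤ G₀
      ∧ ‖bondCompY i a A (shiftY i lam ((shiftY i μ).symm (chartY i b.src)))‖ ≤ G₀)
    (hA₀' : ∀ (p : PlaqY i) (m l : Fin 4), edgeY i p m = b → ‖A (edgeY i p l)‖ ≤ G₀)
    (hA₁ : ∀ a lam μ : Fin (d + 1), ‖cdS i U lam (bondCompY i a A) ((shiftY i μ).symm (chartY i b.src))‖ ≤ G₁
      ∧ ‖cdsS i U μ (bondCompY i a A) (shiftY i lam (chartY i b.src))‖ ≤ G₁)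
    (hAP : ∀ (y : IBondY i) (f : FBondY i), qsK i b y ≠ 0 → qK i y f ≠ 0 → i.w y * ‖A f‖ ≤ P) :
    ‖KhBY i (hTY i c) parB U A b‖
      ≤ |i.cf| * (((d : ℝ) + 1) * (4 * (|i.cf| * ρ * (2 * (C1F d ℓ / (8 / 5 * (bigSide ℓ i.Mh c.1.1 : ℝ))) * G₁
            + (C1F d ℓ / (8 / 5 * (bigSide ℓ i.Mh c.1.1 : ℝ)) * δP + C2X d ℓ / (8 / 5 * (bigSide ℓ i.Mh c.1.1 : ℝ)) ^ 2) * G₀)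
            + C1F d ℓ / (8 / 5 * (bigSide ℓ i.Mh c.1.1 : ℝ)) * δK * G₀)))
        + 64 * ((d : ℝ) + 1) * δI * (C1F d ℓ / (8 / 5 * (bigSide ℓ i.Mh c.1.1 : ℝ))) * G₀
        + i.cf ^ 2 * (((d : ℝ) + 1) * (2 * (C1F d ℓ / (8 / 5 * (bigSide ℓ i.Mh c.1.1 : ℝ))) * G₁
            + (C1F d ℓ / (8 / 5 * (bigSide ℓ i.Mh c.1.1 : ℝ)) * δP + C2X d ℓ / (8 / 5 * (bigSide ℓ i.Mh c.1.1 : ℝ)) ^ 2) * G₀))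
        + 2 * (sLipT d ℓ / (((ℓ : ℝ) + 1) * i.Mh) * (((ℓ : ℝ) + 1) + 3)) * P * ∑ y, |qsK i b y| := by
  rw [KhBY_eq_four, LinearMap.add_apply, LinearMap.add_apply, LinearMap.add_apply, Pi.add_apply, Pi.add_apply, Pi.add_apply]
  -- (1) the Hessian-curl piece (D′₂-loc) with the Jordan insertion `jIns`
  have h1 := norm_cutCommR_sandwich_hTY_apply_le_loc i c U hU hδP (jIns i U) (κ := |i.cf| * ρ) (by positivity) hδK
    (norm_jIns_le i U hρ hRe) (coCurlY i U ∘ₗ jordanY i U ∘ₗ curlY i U) (hessCurlY_apply_eq i U) A b hP hKc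
    (G₀ := G₀) (G₁ := G₁) (fun a lam μ => (hA₀ a lam μ).2) hA₁
  -- (2) the curvature piece (D′₃b-loc)
  have h2 := norm_cutCommR_curv2Y_hTY_apply_le_loc i c U hU hδI A b hI hG₀ hA₀'
  -- (3) the `DD*` piece (D′₁-loc)
  have h3 := norm_cutCommR_gradY_divY_hTY_apply_le_grad_loc i c U hU hδP A b (fun μ => hP μ b.dir) (G₀ := G₀) (G₁ := G₁)
    (fun μ => ⟨(hA₀ μ b.dir μ).1, (hA₀ μ b.dir μ).2⟩) (fun μ => ⟨(hA₁ μ b.dir μ).1, (hA₁ μ b.dir μ).2⟩)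
  -- (4) the averaging piece (D′₃a, no holonomy data)
  have h4 := norm_cutCommR_QsY_aY_QY_hTY_apply_le i c parB U hT A b (P := P) hAP
  exact (norm_add_le _ _).trans (add_le_add ((norm_add_le _ _).trans (add_le_add ((norm_add_le _ _).trans (add_le_add h1 h2)) h3)) h4)

end Literature.MathematicalPhysics.QuantumFieldTheory.Balaban1983to89.B9Eq3104CommutatorSizesLoc

end
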